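/-
Solo-blind KontsevichZagierPeriods, session s21 — ALL DEPTHS at the base point y = -1:
the corner of a bracket-tree element on a word-of-blocks structure; (T1), (T2), (T3) of the
Lyndon unitriangularity, as kernel theorems modulo the interval rule and normalised lifts.
-/
import Summits.KontsevichZagierPeriods.KontsevichZagierPeriods.Theorems.SoloBlindAllDepths
import Summits.KontsevichZagierPeriods.KontsevichZagierPeriods.Theorems.SoloBlindLieTrees

/-!
# Lyndon unitriangularity of the corner matrix: (T1), (T2), (T3)

Assembly of `SoloBlindDepthThree` (chain rule), `SoloBlindAllDepths` (interval rule, pigeonhole,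
interlacing) and `SoloBlindLieTrees` (bracket trees, (Λ1)/(Λ2) for good trees).  Context (paper
level, `hodge.md` §8.12 THEOREM D.25 of the solo-blind notes, NOT formalised here): for an odd
Lyndon word `n` the element `P_n` is the standard bracketing of `n` evaluated on lifted block
corners `W m` (homogeneous of degree `deg m`); on the summand of a word of blocks `e'` (same weight)
every lift satisfies the INTERVAL RULE for the boundary set of `e'`, and the `(0, w)`-corner
`J[rev e', n]` of `P_n` there is claimed to vanish when `e'` has fewer blocks than `n` has letters
(T1) or when `rev e' ≺ n` (T2), and to equal `(-1)^(k+1)` on the home summand `e' = rev n` (T3).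
Here these three statements are PROVED for an arbitrary good bracket tree and abstract lifts:

* `bset e` — the boundary set `{0, a₁, a₁+a₂, …}` of a word of blocks with positive entries,
  `card_bset`; `sum_take_le_of_count` — the counting form of the interlacing (8.12.5) forces
  prefix-sum domination; `eq_or_dlex_of_sum_take_le` — domination with equal totals forces
  `d = e ∨ rev d ≺ rev e` ("read from the outer end");
* `eval_corner` — the corner of `eval W T` is the signed sum of the chain products of the
  arrangements; `eq_or_dlex_of_chain_ne_zero` — a nonzero chain forces `d = e' ∨ rev d ≺ rev e'`;
* **(T1)** `eval_eq_zero_of_card_lt`, **(T2)** `corner_eq_zero_of_dlex` /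
  `not_dlex_of_corner_ne_zero`, **(T3)** `corner_home` (`= (-1)^(k+1) * chain of the home
  arrangement`) and `corner_home_of_normalised` (`= (-1)^(k+1)` when that chain is `1`, i.e. for
  normalised lifts).

So the unitriangularity of THEOREM D.25 is a kernel implication modulo exactly: the tree is good
(standard bracketing of a Lyndon word), the lifts are homogeneous and satisfy the interval rule
(Lemma 8.12.1), and the home chain is normalised.  Nothing about periods, Hodge theory or the
Kontsevich–Zagier statement is claimed in this file.
-/

namespace Summit.KontsevichZagierPeriods.KontsevichZagierPeriods.Theorems

namespace SoloBlind

namespace LyndonCorner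

open Matrix PolylogLadder DepthTwo DepthThree AllDepths LieTrees LieTrees.BTree

variable {K : Type*} [CommRing K] {n : ℕ} {ι : Type*}

local notation "𝕄" => Matrix (Fin (n + 2)) (Fin (n + 2)) K

/-! ## Prefix sums and the boundary set of a word of blocks -/

/-- The boundary set of a word of blocks `e = (a₁,…,a_k)`: the proper prefix sums
`0, a₁, a₁ + a₂, …, a₁ + ⋯ + a_{k-1}`. -/
def bset (e : List ℕ) : Finset ℕ := (Finset.range e.length).image fun j => (e.take j).sum

/-- Prefix sums do not decrease in one step. -/
theorem sum_take_le_succ (e : List ℕ) (m : ℕ) : (e.take m).sum ≤ (e.take (m + 1)).sum := by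
  by_cases hm : m < e.length
  · rw [List.sum_take_succ e m hm]
    exact Nat.le_add_right _ _
  · rw [List.take_of_length_le (by omega), List.take_of_length_le (by omega)]

/-- Prefix sums are monotone. -/
theorem sum_take_mono (e : List ℕ) (i : ℕ) : ∀ t : ℕ, (e.take i).sum ≤ (e.take (i + t)).sum
  | 0 => le_rfl
  | t + 1 => (sum_take_mono e i t).trans (sum_take_le_succ e (i + t))

/-- Prefix sums of a word with positive entries increase strictly (within the word). -/
theorem sum_take_lt_of_lt (e : List ℕ) (he : ∀ x ∈ e, 0 < x) {i j : ℕ} (hij : i < j)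
    (hj : j ≤ e.length) : (e.take i).sum < (e.take j).sum := by
  obtain ⟨j, rfl⟩ : ∃ j', j = j' + 1 := ⟨j - 1, by omega⟩
  have hjl : j < e.length := by omega
  obtain ⟨t, rfl⟩ : ∃ t, j = i + t := ⟨j - i, by omega⟩
  calc (e.take i).sum ≤ (e.take (i + t)).sum := sum_take_mono e i t
    _ < (e.take (i + t + 1)).sum := by
      rw [List.sum_take_succ e (i + t) hjl]
      exact Nat.lt_add_of_pos_right (he _ (List.getElem_mem hjl))

/-- The prefix-sum map is injective on the indices of the word (positive entries). -/
theorem take_sum_injOn (e : List ℕ) (he : ∀ x ∈ e, 0 < x) :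
    Set.InjOn (fun j => (e.take j).sum) (Finset.range e.length : Set ℕ) := by
  intro i hi j hj h
  simp only [Finset.coe_range, Set.mem_Iio] at hi hj
  by_contra hne
  rcases Nat.lt_or_gt_of_ne hne with hlt | hlt
  · exact absurd h (ne_of_lt (sum_take_lt_of_lt e he hlt hj.le))
  · exact absurd h (ne_of_gt (sum_take_lt_of_lt e he hlt hi.le))

/-- A word of `k` blocks has exactly `k` boundaries. -/
theorem card_bset (e : List ℕ) (he : ∀ x ∈ e, 0 < x) : (bset e).card = e.length := by
  rw [bset, Finset.card_image_of_injOn (take_sum_injOn e he), Finset.card_range]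

/-- Proper prefix sums are boundaries. -/
theorem mem_bset {e : List ℕ} {j : ℕ} (hj : j < e.length) : (e.take j).sum ∈ bset e :=
  Finset.mem_image.mpr ⟨j, Finset.mem_range.mpr hj, rfl⟩

/-- INTERLACING ⟹ DOMINATION.  If for every `l ≤ k` exactly `l` boundaries of `e` lie strictly
below the `l`-th prefix sum of `d` (the counting form (8.12.5) of `card_filter_lt_chainPoint_eq`),
then the prefix sums of `d` are dominated by those of `e`. -/
theorem sum_take_le_of_count (e d : List ℕ) (he : ∀ x ∈ e, 0 < x)
    (hcount : ∀ l ≤ e.length, ((bset e).filter (fun β => β < (d.take l).sum)).card = l)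
    {j : ℕ} (hj : j < e.length) : (d.take j).sum ≤ (e.take j).sum := by
  by_contra h
  rw [not_le] at h
  have hsub : (Finset.range (j + 1)).image (fun i => (e.take i).sum) ⊆
      (bset e).filter (fun β => β < (d.take j).sum) := by
    intro β hβ
    obtain ⟨i, hi, rfl⟩ := Finset.mem_image.mp hβ
    rw [Finset.mem_range] at hi
    obtain ⟨t, rfl⟩ : ∃ t, j = i + t := ⟨j - i, by omega⟩
    exact Finset.mem_filter.mpr ⟨mem_bset (by omega), lt_of_le_of_lt (sum_take_mono e i t) h⟩
  have hinj : Set.InjOn (fun i => (e.take i).sum) (Finset.range (j + 1) : Set ℕ) :=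
    (take_sum_injOn e he).mono (by
      intro i hi
      simp only [Finset.coe_range, Set.mem_Iio] at hi ⊢
      omega)
  have h1 := Finset.card_le_card hsub
  rw [Finset.card_image_of_injOn hinj, Finset.card_range, hcount j hj.le] at h1
  omega

/-- DOMINATION ⟹ LEX, "read from the outer end".  Two words of the same length and total whose
REVERSALS have dominated prefix sums (`rev D` below `rev E`) are equal or compare `D ≺ E` in
Deligne's order: at the last place where the reversals differ, `D` carries the larger letter. -/
theorem eq_or_dlex_of_sum_take_le : ∀ (D E : List ℕ), D.length = E.length → D.sum = E.sum →
    (∀ j < D.length, (D.reverse.take j).sum ≤ (E.reverse.take j).sum) → D = E ∨ DLex D E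
  | [], [], _, _, _ => Or.inl rfl
  | [], _ :: _, h, _, _ => by simp at h
  | _ :: _, [], h, _, _ => by simp at h
  | x :: D, y :: E, hlen, hsum, h => by
    simp only [List.length_cons, Nat.add_right_cancel_iff] at hlen
    simp only [List.sum_cons] at hsum
    have hD : ∀ j ≤ D.length, (x :: D).reverse.take j = D.reverse.take j := fun j hj => by
      rw [List.reverse_cons, List.take_append_of_le_length (by simpa using hj)]
    have hE : ∀ j ≤ E.length, (y :: E).reverse.take j = E.reverse.take j := fun j hj => by
      rw [List.reverse_cons, List.take_append_of_le_length (by simpa using hj)]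
    have key : D.sum ≤ E.sum := by
      have := h D.length (by simp)
      rw [hD D.length le_rfl, hE D.length hlen.le, List.take_of_length_le (by simp),
        List.take_of_length_le (by simp [hlen]), List.sum_reverse, List.sum_reverse] at this
      exact this
    rcases Nat.lt_or_ge y x with hyx | hxy
    · exact Or.inr (dlex_cons_iff.mpr (Or.inl hyx))
    · have hxy' : x = y := by omega
      subst hxy'
      have hsum' : D.sum = E.sum := by omega
      have ih := eq_or_dlex_of_sum_take_le D E hlen hsum' (fun j hj => by
        have := h j (by simp; omega)
        rwa [hD j hj.le, hE j (hlen ▸ hj.le)] at this)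
      rcases ih with h' | h'
      · exact Or.inl (by rw [h'])
      · exact Or.inr (dlex_cons_iff.mpr (Or.inr ⟨rfl, h'⟩))

/-! ## The corner of a bracket-tree element -/

/-- The (degree, matrix) list of an arrangement of letters: input format of `chain`. -/
def lifts (deg : ι → ℕ) (W : ι → 𝕄) (u : List ι) : List (ℕ × 𝕄) := u.map fun m => (deg m, W m)

omit [CommRing K] in
/-- The degrees of the lifts are the value word. -/
theorem lifts_map_fst (deg : ι → ℕ) (W : ι → 𝕄) (u : List ι) :
    (lifts deg W u).map Prod.fst = u.map deg := by
  rw [lifts, List.map_map]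
  rfl

omit [CommRing K] in
/-- The matrices of the lifts are the letters. -/
theorem lifts_map_snd (deg : ι → ℕ) (W : ι → 𝕄) (u : List ι) :
    (lifts deg W u).map Prod.snd = u.map W := by
  rw [lifts, List.map_map]
  rfl

omit [CommRing K] in
/-- Length of the lift list. -/
theorem lifts_length (deg : ι → ℕ) (W : ι → 𝕄) (u : List ι) :
    (lifts deg W u).length = u.length := by
  simp [lifts]

omit [CommRing K] in
/-- Truncating the lift list. -/
theorem lifts_take (deg : ι → ℕ) (W : ι → 𝕄) (u : List ι) (l : ℕ) :
    (lifts deg W u).take l = lifts deg W (u.take l) := by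
  rw [lifts, lifts, List.map_take]

omit [CommRing K] in
/-- Members of the lift list. -/
theorem mem_lifts {deg : ι → ℕ} {W : ι → 𝕄} {u : List ι} {q : ℕ × 𝕄} (hq : q ∈ lifts deg W u) :
    ∃ m ∈ u, (deg m, W m) = q :=
  List.mem_map.mp hq

/-- Entries of a list sum of matrices. -/
theorem list_sum_apply (L : List 𝕄) (i j : Fin (n + 2)) :
    L.sum i j = (L.map fun A => A i j).sum := by
  induction L with
  | nil => rfl
  | cons A t ih => rw [List.sum_cons, Matrix.add_apply, ih, List.map_cons, List.sum_cons]

/-- CORNER FORMULA.  For homogeneous lifts and a tree of total degree `n + 1`, the `(0, w)`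
corner of the iterated commutator is the signed sum, over the signed arrangements, of their
chain products from row `0`. -/
theorem eval_corner (deg : ι → ℕ) (W : ι → 𝕄) (hH : ∀ m, Homog (deg m) (W m)) (T : BTree ι)
    (w : Fin (n + 2)) (hw : (w : ℕ) = n + 1) (hdeg : ((word T).map deg).sum = n + 1) :
    (eval W T) 0 w = ((terms K T).map fun p => p.1 * chain (lifts deg W p.2) 0).sum := by
  rw [eval_eq_sum (K := K) W T, list_sum_apply, List.map_map]
  apply congrArg
  apply List.map_congr_left
  intro p hp
  simp only [Function.comp_apply, Matrix.smul_apply, smul_eq_mul]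
  congr 1
  have h := listProd_apply (lifts deg W p.2) ?_ 0 w ?_
  · rw [lifts_map_snd] at h
    exact h
  · intro q hq
    obtain ⟨m, -, rfl⟩ := mem_lifts hq
    exact hH m
  · rw [lifts_map_fst, sum_of_mem_terms deg T hp, hdeg, hw]
    simp

/-- **(T1)**  With fewer boundaries than letters the whole element vanishes (every arrangement is
a product of `k` interval-rule factors and is the zero matrix by the pigeonhole of
`listProd_eq_zero_of_card_lt`). -/
theorem eval_eq_zero_of_card_lt (deg : ι → ℕ) (W : ι → 𝕄) (hH : ∀ m, Homog (deg m) (W m))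
    (B : Finset ℕ) (hI : ∀ m, IntervalRule B (deg m) (W m)) (T : BTree ι)
    (hcard : B.card < (word T).length) : eval W T = 0 := by
  rw [eval_eq_sum (K := K) W T]
  apply List.sum_eq_zero
  intro x hx
  obtain ⟨p, hp, rfl⟩ := List.mem_map.mp hx
  have h := listProd_eq_zero_of_card_lt B (lifts deg W p.2) ?_ ?_ ?_
  · rw [lifts_map_snd] at h
    rw [h, smul_zero]
  · intro q hq
    obtain ⟨m, -, rfl⟩ := mem_lifts hq
    exact hH m
  · intro q hq
    obtain ⟨m, -, rfl⟩ := mem_lifts hq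
    exact hI m
  · rw [lifts_length, length_of_mem_terms T hp]
    exact hcard

/-- KEY STEP.  On the structure with blocks `e` (positive lengths, total `< n + 2`), an
arrangement `u` of the same length and total whose chain from row `0` is NONZERO has value word
`d` with `d = e` or `rev d ≺ rev e`: interlacing (`card_filter_lt_chainPoint_eq`) ⟹ domination
(`sum_take_le_of_count`) ⟹ lex (`eq_or_dlex_of_sum_take_le`). -/
theorem eq_or_dlex_of_chain_ne_zero (deg : ι → ℕ) (W : ι → 𝕄) (e : List ℕ)
    (he : ∀ x ∈ e, 0 < x) (hI : ∀ m, IntervalRule (bset e) (deg m) (W m)) (u : List ι)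
    (hlen : u.length = e.length) (hsum : (u.map deg).sum = e.sum) (hfit : e.sum < n + 2)
    (hne : chain (lifts deg W u) 0 ≠ 0) :
    u.map deg = e ∨ DLex (u.map deg).reverse e.reverse := by
  have hcount : ∀ l ≤ e.length,
      ((bset e).filter (fun β => β < ((u.map deg).take l).sum)).card = l := by
    intro l hl
    have h := card_filter_lt_chainPoint_eq (bset e) (lifts deg W u) ?_ 0
      (fun β _ => Nat.zero_le β) (by rw [card_bset e he, lifts_length, hlen])
      (by simpa [lifts_map_fst, hsum] using hfit) hne l (by rw [lifts_length, hlen]; exact hl)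
    · simpa [lifts_take, lifts_map_fst, List.map_take] using h
    · intro q hq
      obtain ⟨m, -, rfl⟩ := mem_lifts hq
      exact hI m
  have hdom : ∀ j < e.length, ((u.map deg).take j).sum ≤ (e.take j).sum :=
    fun j hj => sum_take_le_of_count e (u.map deg) he hcount hj
  have h := eq_or_dlex_of_sum_take_le (u.map deg).reverse e.reverse (by simp [hlen])
    (by simp [hsum]) (fun j hj => by
      rw [List.reverse_reverse, List.reverse_reverse]
      exact hdom j (by simpa [hlen] using hj))
  rcases h with h | h
  · left
    simpa using congrArg List.reverse h
  · right
    exact h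

/-- **(T2)**  On a structure with as many blocks as the tree has letters, of the same weight,
whose reversed block word is Deligne-SMALLER than the value word of a GOOD tree, the corner of
the tree element vanishes: a surviving arrangement would have `rev d ⪯ rev e ≺ n`, against (Λ2). -/
theorem corner_eq_zero_of_dlex (deg : ι → ℕ) (W : ι → 𝕄) (hH : ∀ m, Homog (deg m) (W m))
    (T : BTree ι) (hT : Good deg T) (w : Fin (n + 2)) (hw : (w : ℕ) = n + 1)
    (hdeg : ((word T).map deg).sum = n + 1) (e : List ℕ) (he : ∀ x ∈ e, 0 < x)
    (hlen : e.length = (word T).length) (hsum : e.sum = n + 1)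
    (hI : ∀ m, IntervalRule (bset e) (deg m) (W m))
    (hlt : DLex e.reverse ((word T).map deg)) : (eval W T) 0 w = 0 := by
  rw [eval_corner deg W hH T w hw hdeg]
  apply List.sum_eq_zero
  intro x hx
  obtain ⟨p, hp, rfl⟩ := List.mem_map.mp hx
  by_cases hc : chain (lifts deg W p.2) 0 = 0
  · rw [hc, mul_zero]
  · exfalso
    have hΛ := not_dlex_of_mem_terms deg T hT hp
    rcases eq_or_dlex_of_chain_ne_zero deg W e he hI p.2
        (by rw [length_of_mem_terms T hp, hlen]) (by rw [sum_of_mem_terms deg T hp, hdeg, hsum])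
        (by omega) hc with h | h
    · exact hΛ (by rw [h]; exact hlt)
    · exact hΛ (dlex_trans h hlt)

/-- **(T2)**, contrapositive form: a nonzero corner forces `rev e ⪰ n`. -/
theorem not_dlex_of_corner_ne_zero (deg : ι → ℕ) (W : ι → 𝕄) (hH : ∀ m, Homog (deg m) (W m))
    (T : BTree ι) (hT : Good deg T) (w : Fin (n + 2)) (hw : (w : ℕ) = n + 1)
    (hdeg : ((word T).map deg).sum = n + 1) (e : List ℕ) (he : ∀ x ∈ e, 0 < x)
    (hlen : e.length = (word T).length) (hsum : e.sum = n + 1)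
    (hI : ∀ m, IntervalRule (bset e) (deg m) (W m)) (hne : (eval W T) 0 w ≠ 0) :
    ¬ DLex e.reverse ((word T).map deg) :=
  fun hlt => hne (corner_eq_zero_of_dlex deg W hH T hT w hw hdeg e he hlen hsum hI hlt)

/-- **(T3)**  On the HOME structure `e = rev n` of a good tree with positive degrees, only the
reversed arrangement survives (by (T2)'s key step and (Λ1)/(Λ2)), with signed multiplicity
`(-1)^(k+1)`: the corner is `(-1)^(k+1)` times the chain of the home arrangement through the
block corners. -/
theorem corner_home (deg : ι → ℕ) (W : ι → 𝕄) (hH : ∀ m, Homog (deg m) (W m)) (T : BTree ι)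
    (hT : Good deg T) (hpos : ∀ m ∈ word T, 0 < deg m) (w : Fin (n + 2))
    (hw : (w : ℕ) = n + 1) (hdeg : ((word T).map deg).sum = n + 1)
    (hI : ∀ m, IntervalRule (bset ((word T).map deg).reverse) (deg m) (W m)) :
    (eval W T) 0 w =
      (-1) ^ ((word T).length + 1) * chain (lifts deg W (word T).reverse) 0 := by
  set e := ((word T).map deg).reverse with he_def
  have he : ∀ x ∈ e, 0 < x := by
    intro x hx
    rw [he_def, List.mem_reverse, List.mem_map] at hx
    obtain ⟨m, hm, rfl⟩ := hx
    exact hpos m hm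
  rw [eval_corner deg W hH T w hw hdeg, ← signedCount_eq (K := K) deg T hT,
    ← List.sum_map_mul_right]
  apply congrArg
  apply List.map_congr_left
  intro p hp
  by_cases hc : (p.2.map deg).reverse = (word T).map deg
  · rw [if_pos hc, (eq_reverse_of_mem_terms deg T hT hp hc).1]
  · rw [if_neg hc, zero_mul]
    by_cases h0 : chain (lifts deg W p.2) 0 = 0
    · rw [h0, mul_zero]
    · exfalso
      rcases eq_or_dlex_of_chain_ne_zero deg W e he hI p.2
          (by rw [length_of_mem_terms T hp, he_def, List.length_reverse, List.length_map])
          (by rw [sum_of_mem_terms deg T hp, he_def, List.sum_reverse])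
          (by rw [he_def, List.sum_reverse, hdeg]; omega) h0 with h | h
      · exact hc (by rw [h, he_def, List.reverse_reverse])
      · exact not_dlex_of_mem_terms deg T hT hp (by rwa [he_def, List.reverse_reverse] at h)

/-- **(T3)**, normalised lifts: if the home chain (the product of the block-corner entries of
the lifts, block by block) is `1`, the diagonal entry of the corner matrix is `(-1)^(k+1)`. -/
theorem corner_home_of_normalised (deg : ι → ℕ) (W : ι → 𝕄) (hH : ∀ m, Homog (deg m) (W m))
    (T : BTree ι) (hT : Good deg T) (hpos : ∀ m ∈ word T, 0 < deg m) (w : Fin (n + 2))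
    (hw : (w : ℕ) = n + 1) (hdeg : ((word T).map deg).sum = n + 1)
    (hI : ∀ m, IntervalRule (bset ((word T).map deg).reverse) (deg m) (W m))
    (hone : chain (lifts deg W (word T).reverse) 0 = 1) :
    (eval W T) 0 w = (-1) ^ ((word T).length + 1) := by
  rw [corner_home deg W hH T hT hpos w hw hdeg hI, hone, mul_one]

end LyndonCorner

end SoloBlind

end Summit.KontsevichZagierPeriods.KontsevichZagierPeriods.Theorems
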